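import Literature.Analysis.ValidatedNumerics.TaylorModelArctan
import HarnessLib

/-!
# The `(1+c²)`-sharp remainder of the Taylor model of `arctan ∘ g`

Trunk T-ANA (Analysis/ValidatedNumerics); namespace `Literature.Analysis.ValidatedNumerics.PolyMP`.
Sequel of `TaylorModelArctan.lean`. There the integral-form remainder of the expansion of `arctan` around a centre
`c`, `arctan (c+u) − arctan c − Σ_{n<K} a_{n+1}(c) u^{n+1}`, is bounded by `|u|^{K+1}/(K+1)` UNIFORMLY in `c`. The
Taylor series of `arctan` around `c` has radius of convergence `√(1+c²)` (the distance from `c` to the poles `±i`);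
on the derivative side this is the closed form

  `arctan⁽ⁿ⁾(x) = (−1)^{n−1} (n−1)! (1+x²)^{−n/2} sin (n · arcsin (1+x²)^{−1/2})`, so `|arctan⁽ⁿ⁾(x)| ≤ (n−1)!/(1+x²)^{n/2}`

(Adegoke–Layeni, Theorem 1), i.e. `|a_n(c)| ≤ 1/(n (1+c²)^{n/2})` — exactly the kind of derivative bound from which
the Taylor model of a basic function takes its remainder (Joldeş, Section 2.2.1). This file records the matching
GEOMETRIC FACTOR in the integral remainder, still with no condition on `u`:

  `|arctan (c+u) − arctan c − Σ_{n<K} a_{n+1}(c) u^{n+1}| ≤ |u|^{K+1} / ((K+1) (1+c²)^J)`   for every `2J ≤ K`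

(`abs_arctan_sub_taylor_le_sharp`): the last term of the partial-fraction identity `inv_one_add_sq_expand` is
`± s^K A/M` with `A = q_{K+1} + s q_K`, `M = (1+c²)^K (1+(c+s)²)` and `A² ≤ M`, hence `|A| (1+c²)^J ≤ M` as soon as
`((1+c²)^J)² ≤ (1+c²)^K ≤ M` (`abs_inv_one_add_sq_rem_le_sharp`), and the bound integrates over `s ∈ [0, u]` as
before. Kernel side: `tatanCompRemS` / `tatanCompIS` / `tatanTMS` are the drop-in variants of `tatanCompRem` /
`tatanCompI` / `tatanTM` with the remainder `⌈S (B/S)^{K+1}/((K+1)(1+c²)^{⌊K/2⌋})⌉` (`tmem_atanCompS`,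
`tmem_atan_of_tatanTMS`); for a centre with `|c| ≥ 1` and `K = 20` the remainder shrinks by at least `2^{10}`
(e.g. `S = 2^40`, `B = 2^39`, `K = 20`, `c = 1`: `tatanCompRem S B K = 24967`, `tatanCompRemS S B K c = 25`).

Problem-independent plumbing for kernel-checked integral certificates with arctangents in the integrand; no facts,
no axioms.

## References

* K. Adegoke, O. Layeni, *The higher derivatives of the inverse tangent function and rapidly convergent BBP-type
  formulas for pi*, Appl. Math. E-Notes 10 (2010) 70–75 (arXiv:1603.08540): Theorem 1 (the closed form of
  `arctan⁽ⁿ⁾`, whence `|arctan⁽ⁿ⁾(x)| ≤ (n−1)!/(1+x²)^{n/2}`) and Theorem 2 (the resulting expansion of `arctan`).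
  [cite: AdegokeLayeni2016, Theorem 1]
* M. Joldeş, *Rigorous Polynomial Approximations and Applications*, PhD thesis, ENS Lyon (2011): Section 2.2.1
  (Taylor models of basic functions, the remainder from "fairly simple formulas [...] for the derivatives of such
  functions", thesis p. 41; the `arctan` rows of Table 1.3, p. 43) and Algorithm 2.2.8 `TMComp`.
  [cite: Joldes2011, Section 2.2.1]
-/

open MeasureTheory intervalIntegral Set

namespace Literature.Analysis.ValidatedNumerics

namespace PolyMP

open Literature.Analysis.ValidatedNumerics.NumericsMP
open Literature.Analysis.ValidatedNumerics.ExpPoly (Poly)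

/-! ### The sharp bound on the last term of `inv_one_add_sq_expand` -/

/-- `|(−1)^K s^K (q_{K+1} + s q_K)/((1+c²)^K (1+(c+s)²))| ≤ |s|^K/(1+c²)^J` whenever `2J ≤ K`
(`(q_{K+1} + s q_K)² ≤ (1+c²)^K (1+(c+s)²)` and `((1+c²)^J)² ≤ (1+c²)^K`): the geometric factor of the radius of
convergence `√(1+c²)`, cf. `|arctan⁽ⁿ⁾(x)| ≤ (n−1)!/(1+x²)^{n/2}`. [cite: AdegokeLayeni2016, Theorem 1] -/
theorem abs_inv_one_add_sq_rem_le_sharp (c s : ℝ) {K J : ℕ} (hJ : 2 * J ≤ K) :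
    |(-1 : ℝ) ^ K * s ^ K * ((cipow c (K + 1)).2 + s * (cipow c K).2) /
        ((1 + c ^ 2) ^ K * (1 + (c + s) ^ 2))| ≤ |s| ^ K / (1 + c ^ 2) ^ J := by
  simp only [cipow_succ]
  set P := (cipow c K).1 with hP
  set Q := (cipow c K).2 with hQ
  have hPQ : P ^ 2 + Q ^ 2 = (1 + c ^ 2) ^ K := cipow_sq_add_sq c K
  have hc1 : (1 : ℝ) ≤ 1 + c ^ 2 := by nlinarith [sq_nonneg c]
  have hcs1 : (1 : ℝ) ≤ 1 + (c + s) ^ 2 := by nlinarith [sq_nonneg (c + s)]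
  have hN0 : (0 : ℝ) < (1 + c ^ 2) ^ J := by positivity
  have hNK : ((1 + c ^ 2) ^ J) ^ 2 ≤ (1 + c ^ 2) ^ K := by
    rw [← pow_mul]
    exact pow_le_pow_right₀ hc1 (by omega)
  set M := (1 + c ^ 2) ^ K * (1 + (c + s) ^ 2) with hM
  have hN2M : ((1 + c ^ 2) ^ J) ^ 2 ≤ M := by
    calc ((1 + c ^ 2) ^ J) ^ 2 ≤ (1 + c ^ 2) ^ K := hNK
      _ = (1 + c ^ 2) ^ K * 1 := (mul_one _).symm
      _ ≤ M := mul_le_mul_of_nonneg_left hcs1 (by positivity)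
  have hM0 : 0 < M := by positivity
  have hA2 : (P + Q * c + s * Q) ^ 2 ≤ M := by
    have e : (P + Q * c + s * Q) ^ 2 + (P * (c + s) - Q) ^ 2 = M := by
      rw [hM, ← hPQ]; ring
    nlinarith [sq_nonneg (P * (c + s) - Q)]
  -- `|A| (1+c²)^J ≤ M` from `(|A| (1+c²)^J)² ≤ M²`
  have hAN : |P + Q * c + s * Q| * (1 + c ^ 2) ^ J ≤ M := by
    have h1 : (|P + Q * c + s * Q| * (1 + c ^ 2) ^ J) ^ 2 ≤ M ^ 2 := by
      rw [mul_pow, sq_abs, sq M]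
      exact mul_le_mul hA2 hN2M (by positivity) hM0.le
    exact (pow_le_pow_iff_left₀ (by positivity) hM0.le two_ne_zero).mp h1
  rw [abs_div, abs_mul, abs_mul, abs_pow, abs_pow, abs_neg, abs_one, one_pow, one_mul, abs_of_pos hM0,
    div_le_div_iff₀ hM0 hN0]
  calc |s| ^ K * |P + Q * c + s * Q| * (1 + c ^ 2) ^ J = |s| ^ K * (|P + Q * c + s * Q| * (1 + c ^ 2) ^ J) := by
        ring
    _ ≤ |s| ^ K * M := mul_le_mul_of_nonneg_left hAN (pow_nonneg (abs_nonneg s) K)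

/-- **`(1+c²)`-sharp Taylor remainder of `arctan` around `c`**: for EVERY real `c`, `u` and all `2J ≤ K`,
`|arctan (c+u) − arctan c − Σ_{n<K} a_{n+1}(c) u^{n+1}| ≤ |u|^{K+1}/((K+1)(1+c²)^J)` (integral form of the
remainder as in `abs_arctan_sub_taylor_le`, its integrand bounded by `abs_inv_one_add_sq_rem_le_sharp`).
[cite: AdegokeLayeni2016, Theorem 1] -/
theorem abs_arctan_sub_taylor_le_sharp (c u : ℝ) {K J : ℕ} (hJ : 2 * J ≤ K) :
    |Real.arctan (c + u) - Real.arctan c - ∑ n ∈ Finset.range K, atanCoeffR c n * u ^ (n + 1)| ≤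
      |u| ^ (K + 1) / ((K + 1) * (1 + c ^ 2) ^ J) := by
  -- the remainder integrand and the polynomial part
  set R : ℝ → ℝ := fun s => (-1 : ℝ) ^ K * s ^ K * ((cipow c (K + 1)).2 + s * (cipow c K).2) /
    ((1 + c ^ 2) ^ K * (1 + (c + s) ^ 2)) with hR
  set α : ℕ → ℝ := fun n => (-1 : ℝ) ^ n * (cipow c (n + 1)).2 / (1 + c ^ 2) ^ (n + 1) with hα
  have hRc : Continuous R := by
    rw [hR]
    refine Continuous.div (by fun_prop) (by fun_prop) fun s => ?_
    positivity
  -- `arctan (c+u) − arctan c = ∫₀ᵘ (1+(c+s)²)⁻¹ ds`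
  have hint : ∫ s in (0 : ℝ)..u, (1 + (c + s) ^ 2)⁻¹ = Real.arctan (c + u) - Real.arctan c := by
    rw [intervalIntegral.integral_comp_add_left (fun x : ℝ => (1 + x ^ 2)⁻¹) c, integral_inv_one_add_sq, add_zero]
  -- expand the integrand
  have hexp : (fun s : ℝ => (1 + (c + s) ^ 2)⁻¹) = fun s => (∑ n ∈ Finset.range K, α n * s ^ n) + R s := by
    funext s
    rw [inv_one_add_sq_expand c s K]
  have hpoly : ∀ n ∈ Finset.range K, IntervalIntegrable (fun s : ℝ => α n * s ^ n) volume 0 u :=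
    fun n _ => (continuous_const.mul (continuous_pow n)).intervalIntegrable _ _
  have hsum : IntervalIntegrable (fun s : ℝ => ∑ n ∈ Finset.range K, α n * s ^ n) volume 0 u :=
    (continuous_finsetSum _ fun n _ => continuous_const.mul (continuous_pow n)).intervalIntegrable _ _
  have hRi : IntervalIntegrable R volume 0 u := hRc.intervalIntegrable _ _
  rw [hexp, intervalIntegral.integral_add hsum hRi, intervalIntegral.integral_finsetSum hpoly] at hint
  have hterm : ∀ n ∈ Finset.range K, ∫ s in (0 : ℝ)..u, α n * s ^ n = atanCoeffR c n * u ^ (n + 1) := by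
    intro n _
    rw [intervalIntegral.integral_const_mul, integral_pow, hα, atanCoeffR]
    have hn : ((n : ℝ) + 1) ≠ 0 := by positivity
    have h1 : (1 + c ^ 2) ^ (n + 1) ≠ 0 := by positivity
    field_simp
    ring
  rw [Finset.sum_congr rfl hterm] at hint
  have key : Real.arctan (c + u) - Real.arctan c - ∑ n ∈ Finset.range K, atanCoeffR c n * u ^ (n + 1) =
      ∫ s in (0 : ℝ)..u, R s := by
    linarith
  rw [key]
  -- bound the remainder integral
  have hN0 : (0 : ℝ) < (1 + c ^ 2) ^ J := by positivity
  have hg : IntegrableOn (fun s : ℝ => |s - 0| ^ K / (1 + c ^ 2) ^ J) (uIoc 0 u) volume :=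
    intervalIntegrable_iff.mp
      ((((continuous_id.sub continuous_const).abs.pow K).div_const _).intervalIntegrable 0 u)
  have hle : ∀ᵐ s ∂(volume.restrict (uIoc (0 : ℝ) u)), ‖R s‖ ≤ |s - 0| ^ K / (1 + c ^ 2) ^ J :=
    Filter.Eventually.of_forall fun s => by
      rw [Real.norm_eq_abs, sub_zero, hR]
      exact abs_inv_one_add_sq_rem_le_sharp c s hJ
  calc |∫ s in (0 : ℝ)..u, R s| = ‖∫ s in uIoc (0 : ℝ) u, R s‖ := by
        rw [← Real.norm_eq_abs, intervalIntegral.norm_intervalIntegral_eq]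
    _ ≤ ∫ s in uIoc (0 : ℝ) u, |s - 0| ^ K / (1 + c ^ 2) ^ J := norm_integral_le_of_norm_le hg hle
    _ = (∫ s in uIoc (0 : ℝ) u, |s - 0| ^ K) / (1 + c ^ 2) ^ J := integral_div _ _
    _ = |u - 0| ^ (K + 1) / (K + 1) / (1 + c ^ 2) ^ J := by rw [integral_pow_abs_sub_uIoc K]
    _ = |u| ^ (K + 1) / ((K + 1) * (1 + c ^ 2) ^ J) := by rw [sub_zero, div_div]

/-! ### `arctan (c + u) − arctan c` for a Taylor-modelled `u`, sharp remainder -/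

/-- Sharp scaled remainder bound `⌈S (B/S)^{K+1}/((K+1)(1+c²)^{⌊K/2⌋})⌉` from a scaled range bound `B` (`|u| S ≤ B`)
and the centre `c`. [cite: AdegokeLayeni2016, Theorem 1] -/
def tatanCompRemS (S : ℕ) (B : ℤ) (K : ℕ) (c : ℚ) : ℤ :=
  ⌈(S : ℚ) * (((B : ℚ) / S) ^ (K + 1) / (((K : ℚ) + 1) * (1 + c ^ 2) ^ (K / 2)))⌉

/-- The Taylor model of `ρ ↦ arctan (c + u ρ) − arctan c` with the sharp remainder: `U ·` Horner on
`atanCoeffs c K` at `U`, plus `tatanCompRemS`. [cite: Joldes2011, Section 2.2.1] -/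
def tatanCompIS (S : ℕ) (h : ℚ) (D K : ℕ) (c : ℚ) (U : IPoly) : IPoly :=
  widen0 (tmulI S h D U (thornerI S h D (atanCoeffs c K) U)) (tatanCompRemS S (tabsI S h U) K c)

/-- `u · Poly.eval (atanCoeffs c K) u = Σ_{n<K} a_{n+1}(c) u^{n+1}`. [folklore] -/
private theorem mul_eval_atanCoeffs_sharp (c : ℚ) (K : ℕ) (u : ℝ) :
    u * Poly.eval (atanCoeffs c K) u = ∑ n ∈ Finset.range K, atanCoeffR (c : ℝ) n * u ^ (n + 1) := by
  rw [atanCoeffs, poly_eval_map_range, Finset.mul_sum]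
  refine Finset.sum_congr rfl fun n _ => ?_
  rw [atanCoeffR, ← (cipow_cast c (n + 1)).2, pow_succ]
  push_cast
  ring

/-- The scaled remainder estimate of `tmem_atanCompS`. [folklore] -/
private theorem atan_rem_scaledS {S : ℕ} (hS : 0 < S) {B : ℤ} {K : ℕ} (c : ℚ) {u r : ℝ}
    (huB : |u| ≤ (B : ℝ) / S)
    (hr : |r| ≤ |u| ^ (K + 1) / (((K : ℝ) + 1) * (1 + (c : ℝ) ^ 2) ^ (K / 2))) :
    |r| * S ≤ (tatanCompRemS S B K c : ℝ) := by
  have hSr : (0 : ℝ) < S := by exact_mod_cast hS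
  have h2 : |u| ^ (K + 1) ≤ ((B : ℝ) / S) ^ (K + 1) := pow_le_pow_left₀ (abs_nonneg _) huB _
  have hK : (0 : ℝ) < ((K : ℝ) + 1) * (1 + (c : ℝ) ^ 2) ^ (K / 2) := by positivity
  have h3 : |r| ≤ ((B : ℝ) / S) ^ (K + 1) / (((K : ℝ) + 1) * (1 + (c : ℝ) ^ 2) ^ (K / 2)) :=
    hr.trans (div_le_div_of_nonneg_right h2 hK.le)
  have h4 : ((S : ℚ) * ((((B : ℚ) / S) ^ (K + 1)) / (((K : ℚ) + 1) * (1 + c ^ 2) ^ (K / 2))) : ℝ) ≤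
      (tatanCompRemS S B K c : ℝ) := by
    unfold tatanCompRemS; exact_mod_cast Int.le_ceil _
  refine le_trans ?_ h4
  push_cast
  rw [mul_comm ((S : ℕ) : ℝ)]
  exact mul_le_mul_of_nonneg_right h3 hSr.le

/-- **Soundness of `tatanCompIS`** (no range condition: the sharp remainder bound holds for every `u`).
[cite: Joldes2011, Section 2.2.1] -/
theorem tmem_atanCompS {S : ℕ} (hS : 0 < S) {h : ℚ} (h0 : 0 ≤ h) (D K : ℕ) (c : ℚ) {u : ℝ → ℝ} {U : IPoly}
    (hu : TMem S h u U) :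
    TMem S h (fun ρ => Real.arctan ((c : ℝ) + u ρ) - Real.arctan (c : ℝ)) (tatanCompIS S h D K c U) := by
  intro ρ hρ
  have hP := tmem_mul hS h0 D hu (tmem_horner hS h0 D hu (atanCoeffs c K))
  obtain ⟨as, has, hev⟩ := hP ρ hρ
  have hSr : (0 : ℝ) < S := by exact_mod_cast hS
  have habs := abs_le_tabsI h0 hu hρ
  have huB : |u ρ| ≤ ((tabsI S h U : ℤ) : ℝ) / S := by rw [le_div_iff₀ hSr]; exact habs
  have hrem := abs_arctan_sub_taylor_le_sharp (c : ℝ) (u ρ) (Nat.mul_div_le K 2)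
  rw [← mul_eval_atanCoeffs_sharp] at hrem
  have hδle := atan_rem_scaledS hS c huB hrem
  obtain ⟨bs, hbs, hev2⟩ := exists_widen0 has hδle ρ
  refine ⟨bs, hbs, ?_⟩
  rw [hev2, ← hev]
  ring

/-! ### `arctan ∘ g`, sharp remainder -/

/-- The Taylor model of `arctan ∘ g` with the sharp remainder, together with its acceptance flag: as `tatanTM` with
`tatanCompIS` in place of `tatanCompI`. [cite: Joldes2011, Algorithm 2.2.8] -/
def tatanTMS (S : ℕ) (h : ℚ) (D K Ka : ℕ) (G : IPoly) : IPoly × Bool :=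
  match tatanPt S Ka (mid0 S G) with
  | none => ([], false)
  | some A => (taddI (tconst A) (tatanCompIS S h D K (mid0 S G) (tcentre S G)), true)

/-- **Soundness of `tatanTMS`.** [cite: Joldes2011, Algorithm 2.2.8] -/
theorem tmem_atan_of_tatanTMS {S : ℕ} (hS : 0 < S) {h : ℚ} (h0 : 0 ≤ h) {D K Ka : ℕ} {g : ℝ → ℝ} {G : IPoly}
    (hg : TMem S h g G) (hok : (tatanTMS S h D K Ka G).2 = true) :
    TMem S h (fun ρ => Real.arctan (g ρ)) (tatanTMS S h D K Ka G).1 := by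
  unfold tatanTMS at hok ⊢
  rcases hA : tatanPt S Ka (mid0 S G) with _ | A
  · simp only [hA] at hok; exact absurd hok Bool.false_ne_true
  · simp only [hA] at hok ⊢
    clear hok
    have hatan := mem_tatanPt hS hA
    have hU := tmem_centre hg
    have hsum := tmem_add (tmem_const (h := h) hatan) (tmem_atanCompS hS h0 D K (mid0 S G) hU)
    intro ρ hρ
    obtain ⟨as, has, hev⟩ := hsum ρ hρ
    refine ⟨as, has, ?_⟩
    rw [← hev]
    show Real.arctan (g ρ) = Real.arctan ((mid0 S G : ℚ) : ℝ) +
      (Real.arctan (((mid0 S G : ℚ) : ℝ) + (g ρ - ((mid0 S G : ℚ) : ℝ))) - Real.arctan ((mid0 S G : ℚ) : ℝ))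
    rw [add_sub_cancel, add_sub_cancel]

end PolyMP

end Literature.Analysis.ValidatedNumerics
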